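import Literature.NumberTheory.GaloisRepresentations.InertiaLiftAbsoluteProofs
import Literature.NumberTheory.GaloisRepresentations.IntegralGaloisAction
import Mathlib.FieldTheory.KummerPolynomial
import Mathlib.NumberTheory.Real.Irrational
import Mathlib.RingTheory.IntegralClosure.IntegrallyClosed
import Mathlib.Algebra.Polynomial.Degree.SmallDegree
import HarnessLib

/-!
# Inertia at `p` acts non-trivially on `√p`: an element of `I_𝔓 ≤ Gal(ℚ̄/ℚ)` with `σ √p = -√p`

Topic `GaloisRepresentations`.  For a prime number `p`, a prime `𝔓` of `\bar ℤ = absIntegers (𝓞 ℚ) ℚ`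
above `p` and a square root `s = √p ∈ ℚ̄`, **some element `σ` of the absolute inertia group
`I_𝔓 = 𝔓.inertia Γ_ℚ` (Mathlib `Ideal.inertia`) satisfies `σ s = -s`**
(`exists_mem_inertia_smul_eq_neg_of_sq_eq_prime`).  Equivalently: the quadratic field `ℚ(√p)`
is ramified at `p` — its non-trivial automorphism lies in the inertia group of the prime above
`p` — and inertia groups are functorial (surject) along `ℚ̄ ⊇ ℚ(√p) ⊇ ℚ`.

This is textbook algebraic number theory (Neukirch, *Algebraic Number Theory*, Ch. I §8,
Example before (8.4) / Exercise: the primes dividing the discriminant `p` or `4p` of `ℚ(√p)`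
ramify; Ch. I §9, (9.4)–(9.6): inertia groups and their functoriality; Serre, *Local Fields*,
Ch. I §7, Prop. 22 (b)).  In the tree it is the missing input of the computation of the Artin
conductor of the twisted torus `V_ℓ(E_ns)` of a non-split nodal cubic
(`EllipticCurves/NonsplitNodeTateModule`: an inertia element negating `√a` acts as `-1`), i.e. of
the counterexample to the singular clause of the conductor schemas of
`EllipticCurves/BSDConductor` (`BSDConductorSingularProofs`).

## Proof

Let `E = ℚ(s) ⊆ ℚ̄`.  `X² - p` is irreducible over `ℚ` (`√p` is irrational), so `[E : ℚ] = 2`,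
`E/ℚ` is normal (Mathlib `Algebra.IsQuadraticExtension.normal`) and there is `g ∈ Aut(E/ℚ)` with
`g s = -s` (Mathlib `minpoly.exists_algEquiv_of_root'`).  We check that `g` lies in the inertia
group of `𝔓_E = 𝔓 ∩ E` (`mem_inertia_comap_of_apply_gen_eq_neg`): for an algebraic integer
`x = c₀ + c₁ s` of `E` (`c₀, c₁ ∈ ℚ`, power basis), `δ = g x - x = -2 c₁ s` is an algebraic
integer with `δ² = 4 c₁² p =: m ∈ ℤ` and `δ s = -2 c₁ p =: n ∈ ℤ` (rational algebraic integers
are integers), and `m p = n²`; hence `p ∣ n`, `m = p (n/p)²`, so `δ² ∈ p \bar ℤ ⊆ 𝔓` and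
`δ ∈ 𝔓` as `𝔓` is prime.  Finally the tree's **inertia surjects onto inertia**
(`Literature.NumberTheory.GaloisRepresentations.exists_mem_inertia_absRestrictNormalHom_eq`,
Serre I §7 Prop. 22 (b) for `ℚ̄/E/ℚ`, file `InertiaLiftAbsoluteProofs`) lifts `g` to `σ ∈ I_𝔓`,
and `σ s = g s = -s`.

## Mathlib

Mathlib has `Ideal.inertia`, `Ideal.ramificationIdx`, quadratic and cyclotomic rings of
integers, `X_pow_sub_C_irreducible_iff_of_prime`, `Nat.Prime.irrational_sqrt`,
`minpoly.exists_algEquiv_of_root'`, `Algebra.IsQuadraticExtension.normal`; it has no statement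
producing an element of an (absolute) inertia group acting non-trivially on a ramified
quadratic subfield (`lean search 'inertia.*sqrt|sqrt.*inertia|quadratic.*inertia'`: no hits in
Mathlib or the tree).

## References

* J. Neukirch, *Algebraic Number Theory* (1999), Ch. I §8 (ramification in quadratic fields) and
  §9, (9.4)–(9.6) (inertia groups). [NeukirchANT1999]
* J.-P. Serre, *Local Fields*, GTM 67 (1979), Ch. I §7, Prop. 22 (b). [SerreLocalFields1979]

## Design

Theorems only; `namespace Literature.NumberTheory.GaloisRepresentations` (the file's path).  The
intermediate statements about `E = ℚ⟮s⟯` are internal: instance search equips `ℚ⟮s⟯` with the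
`ℚ`-algebra structure `DivisionRing.toRatAlgebra`, which is definitionally but not reducibly equal
to `IntermediateField.algebra`, so where a generic declaration quantifies `[Normal K E]` /
`[FiniteDimensional K E]` over an `IntermediateField` variable the instances are passed
explicitly (`@exists_mem_inertia_absRestrictNormalHom_eq …`, `@AlgEquiv.restrictNormalHom_apply …`)
rather than found by synthesis; no instance or priority is declared.  The exported statement
`exists_mem_inertia_smul_eq_neg_of_sq_eq_prime` mentions only `Γ_ℚ`, `I_𝔓` and `s`.
-/

noncomputable section

open scoped NumberField Polynomial IntermediateField
open Polynomial Field IsDedekindDomain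

namespace Literature.NumberTheory.GaloisRepresentations

/-! ### `ℚ(√p)`: degree, normality, the conjugation -/

/-- `X² - p` is irreducible over `ℚ` for a prime `p` (`√p` is irrational; Mathlib
`X_pow_sub_C_irreducible_iff_of_prime`, `Nat.Prime.irrational_sqrt`). [folklore] -/
theorem irreducible_X_sq_sub_C_prime {p : ℕ} (hp : p.Prime) :
    Irreducible (X ^ 2 - C (p : ℚ) : ℚ[X]) := by
  refine (X_pow_sub_C_irreducible_iff_of_prime Nat.prime_two).mpr fun b hb ↦ ?_
  have hreal : ((|b| : ℚ) : ℝ) = Real.sqrt p := by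
    rw [Rat.cast_abs, ← Real.sqrt_sq_eq_abs, ← Rat.cast_pow, hb, Rat.cast_natCast]
  exact hp.irrational_sqrt.ne_rat |b| hreal.symm

section SqrtPrime

variable {p : ℕ} (hp : p.Prime) {s : AlgebraicClosure ℚ} (hs : s ^ 2 = (p : AlgebraicClosure ℚ))
include hp hs

omit hp in
/-- A square root of `p` in `ℚ̄` is integral over `ℚ`. [folklore] -/
theorem isIntegral_of_sq_eq_prime : IsIntegral ℚ s :=
  IsIntegral.of_pow two_pos (by
    rw [hs, ← map_natCast (algebraMap ℚ (AlgebraicClosure ℚ)) p]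
    exact isIntegral_algebraMap)

/-- For a prime `p` and `s ∈ ℚ̄` with `s² = p`: `minpoly ℚ s = X² - p`. [folklore] -/
theorem minpoly_eq_of_sq_eq_prime : minpoly ℚ s = X ^ 2 - C (p : ℚ) := by
  refine (minpoly.eq_of_irreducible_of_monic (irreducible_X_sq_sub_C_prime hp) ?_
    (monic_X_pow_sub_C _ two_ne_zero)).symm
  simp [hs]

/-- `[ℚ(√p) : ℚ] = 2`. [folklore] -/
theorem finrank_adjoin_eq_two_of_sq_eq_prime : Module.finrank ℚ ℚ⟮s⟯ = 2 := by
  rw [IntermediateField.adjoin.finrank (isIntegral_of_sq_eq_prime hs),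
    minpoly_eq_of_sq_eq_prime hp hs, natDegree_X_pow_sub_C]

/-- `ℚ(√p)/ℚ` is a quadratic extension (hence normal, Mathlib
`Algebra.IsQuadraticExtension.normal`). [folklore] -/
theorem isQuadraticExtension_adjoin_of_sq_eq_prime : Algebra.IsQuadraticExtension ℚ ℚ⟮s⟯ :=
  { finrank_eq_two' := finrank_adjoin_eq_two_of_sq_eq_prime hp hs }

/-- **The conjugation of `ℚ(√p)`**: an automorphism `g` of `ℚ(√p)/ℚ` with `g √p = -√p`
(`-√p` is the other root of `minpoly ℚ √p = X² - p`; Mathlib `minpoly.exists_algEquiv_of_root'`).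
[folklore] -/
theorem exists_algEquiv_apply_gen_eq_neg :
    ∃ g : ℚ⟮s⟯ ≃ₐ[ℚ] ℚ⟮s⟯,
      (g (IntermediateField.AdjoinSimple.gen ℚ s) : AlgebraicClosure ℚ) = -s := by
  haveI := isQuadraticExtension_adjoin_of_sq_eq_prime hp hs
  haveI : FiniteDimensional ℚ ℚ⟮s⟯ :=
    IntermediateField.adjoin.finiteDimensional (isIntegral_of_sq_eq_prime hs)
  have hneg : -s ∈ ℚ⟮s⟯ := neg_mem (IntermediateField.mem_adjoin_simple_self ℚ s)
  obtain ⟨g, hg⟩ := minpoly.exists_algEquiv_of_root' (K := ℚ) (L := ℚ⟮s⟯) (x := ⟨-s, hneg⟩)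
    (y := IntermediateField.AdjoinSimple.gen ℚ s) (Algebra.IsAlgebraic.isAlgebraic _) (by
      erw [IntermediateField.minpoly_gen ℚ s]
      rw [minpoly_eq_of_sq_eq_prime hp hs]
      apply (map_eq_zero_iff _ (algebraMap ℚ⟮s⟯ (AlgebraicClosure ℚ)).injective).mp
      rw [← aeval_algebraMap_apply]
      change aeval (-s) (X ^ 2 - C (p : ℚ)) = 0
      simp [hs])
  exact ⟨g, by rw [hg]⟩

/-! ### The conjugation is an inertia element at `p` -/

omit hp hs in
/-- A rational number which, viewed in `ℚ̄`, is integral over `𝓞 ℚ` is an integer (`ℤ` is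
integrally closed). [folklore] -/
theorem exists_intCast_eq_of_isIntegral {q : ℚ}
    (hq : IsIntegral (𝓞 ℚ) (algebraMap ℚ (AlgebraicClosure ℚ) q)) : ∃ m : ℤ, (m : ℚ) = q := by
  have h1 : IsIntegral (𝓞 ℚ) q :=
    (isIntegral_algebraMap_iff (algebraMap ℚ (AlgebraicClosure ℚ)).injective).mp hq
  have h2 : IsIntegral ℤ q := isIntegral_trans q h1
  obtain ⟨m, hm⟩ := IsIntegrallyClosed.isIntegral_iff.mp h2
  exact ⟨m, by simpa using hm⟩

/-- **The conjugation of `ℚ(√p)` lies in the inertia group of the prime above `p`.**  Let `𝔓` be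
a prime of `\bar ℤ = absIntegers (𝓞 ℚ) ℚ` containing `p`, `𝔓_E = 𝔓 ∩ ℚ(√p)`
(`𝔓.comap (E.integralClosureToAbsIntegers (𝓞 ℚ))`) and `g ∈ Aut(ℚ(√p)/ℚ)` with `g √p = -√p`.
Then `g ∈ I(𝔓_E)` (Mathlib `Ideal.inertia`: `g x - x ∈ 𝔓_E` for every algebraic integer `x` of
`ℚ(√p)`): writing `x = c₀ + c₁ √p`, `δ = g x - x = -2c₁√p` has `δ² = m`, `δ √p = n` with
`m, n ∈ ℤ` and `m p = n²`, so `p ∣ m`, `δ² ∈ p \bar ℤ ⊆ 𝔓`, `δ ∈ 𝔓`.  This is the ramification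
of `p` in `ℚ(√p)` (Neukirch, *ANT*, Ch. I §8; §9 (9.4)). [cite: NeukirchANT1999, Ch. I §9 (9.4) with §8] -/
theorem mem_inertia_comap_of_apply_gen_eq_neg {𝔓 : Ideal (absIntegers (𝓞 ℚ) ℚ)} [𝔓.IsPrime]
    (hp𝔓 : algebraMap (𝓞 ℚ) (absIntegers (𝓞 ℚ) ℚ) p ∈ 𝔓) (g : ℚ⟮s⟯ ≃ₐ[ℚ] ℚ⟮s⟯)
    (hg : (g (IntermediateField.AdjoinSimple.gen ℚ s) : AlgebraicClosure ℚ) = -s) :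
    g ∈ (𝔓.comap ((ℚ⟮s⟯).integralClosureToAbsIntegers (𝓞 ℚ))).inertia (ℚ⟮s⟯ ≃ₐ[ℚ] ℚ⟮s⟯) := by
  rw [Ideal.inertia, AddSubgroup.mem_inertia]
  intro x
  rw [Submodule.mem_toAddSubgroup, Ideal.mem_comap]
  set y : absIntegers (𝓞 ℚ) ℚ := (ℚ⟮s⟯).integralClosureToAbsIntegers (𝓞 ℚ) (g • x - x)
    with hy_def
  -- the power basis `1, √p` of `ℚ(√p)`
  set pb := IntermediateField.adjoin.powerBasis (isIntegral_of_sq_eq_prime hs)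
    with hpb
  have hdim : pb.dim = 2 := by
    rw [hpb, IntermediateField.adjoin.powerBasis_dim, minpoly_eq_of_sq_eq_prime hp hs,
      natDegree_X_pow_sub_C]
  have hgen : algebraMap ℚ⟮s⟯ (AlgebraicClosure ℚ) pb.gen = s := by
    rw [hpb, IntermediateField.adjoin.powerBasis_gen, IntermediateField.AdjoinSimple.algebraMap_gen]
  have hggen : algebraMap ℚ⟮s⟯ (AlgebraicClosure ℚ) (g pb.gen) = -s := by
    rw [hpb, IntermediateField.adjoin.powerBasis_gen]; exact hg
  obtain ⟨f, hfdeg, hfx⟩ := pb.exists_eq_aeval (x : ℚ⟮s⟯)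
  have hf : f = C (f.coeff 1) * X + C (f.coeff 0) := eq_X_add_C_of_natDegree_le_one (by omega)
  set c₁ : ℚ := f.coeff 1
  set c₀ : ℚ := f.coeff 0
  -- coordinates: `x = c₁ √p + c₀`, `g x = -c₁ √p + c₀`
  have hxE : (x : ℚ⟮s⟯) = algebraMap ℚ ℚ⟮s⟯ c₁ * pb.gen + algebraMap ℚ ℚ⟮s⟯ c₀ := by
    rw [hfx]
    conv_lhs => rw [hf]
    simp [map_add, map_mul, aeval_C, aeval_X]
  have hgxE : g (x : ℚ⟮s⟯) = algebraMap ℚ ℚ⟮s⟯ c₁ * g pb.gen + algebraMap ℚ ℚ⟮s⟯ c₀ := by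
    rw [hxE, map_add, map_mul, AlgEquiv.commutes, AlgEquiv.commutes]
  have hxL : algebraMap ℚ⟮s⟯ (AlgebraicClosure ℚ) (x : ℚ⟮s⟯) =
      algebraMap ℚ (AlgebraicClosure ℚ) c₁ * s + algebraMap ℚ (AlgebraicClosure ℚ) c₀ := by
    rw [hxE, map_add, map_mul, hgen, ← IsScalarTower.algebraMap_apply,
      ← IsScalarTower.algebraMap_apply]
  have hgxL : algebraMap ℚ⟮s⟯ (AlgebraicClosure ℚ) (g (x : ℚ⟮s⟯)) =
      algebraMap ℚ (AlgebraicClosure ℚ) c₁ * (-s) + algebraMap ℚ (AlgebraicClosure ℚ) c₀ := by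
    rw [hgxE, map_add, map_mul, hggen, ← IsScalarTower.algebraMap_apply,
      ← IsScalarTower.algebraMap_apply]
  have hyL : (y : AlgebraicClosure ℚ) = -(2 * algebraMap ℚ (AlgebraicClosure ℚ) c₁ * s) := by
    have h1 : (y : AlgebraicClosure ℚ) = algebraMap ℚ⟮s⟯ (AlgebraicClosure ℚ)
        ((g • x - x : integralClosure (𝓞 ℚ) ℚ⟮s⟯) : ℚ⟮s⟯) := rfl
    rw [h1, AddSubgroupClass.coe_sub, integralClosure.coe_smul, map_sub, AlgEquiv.smul_def, hgxL,
      hxL]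
    ring
  -- integrality
  have hyint : IsIntegral (𝓞 ℚ) (y : AlgebraicClosure ℚ) := y.2
  have hsint : IsIntegral (𝓞 ℚ) s := IsIntegral.of_pow two_pos (by
    rw [hs, ← map_natCast (algebraMap (𝓞 ℚ) (AlgebraicClosure ℚ)) p]
    exact isIntegral_algebraMap)
  have hy2 : (y : AlgebraicClosure ℚ) ^ 2 = algebraMap ℚ (AlgebraicClosure ℚ) (4 * c₁ ^ 2 * p) := by
    rw [hyL, map_mul, map_mul, map_pow, map_natCast, map_ofNat]
    rw [show (-(2 * algebraMap ℚ (AlgebraicClosure ℚ) c₁ * s)) ^ 2 =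
      4 * (algebraMap ℚ (AlgebraicClosure ℚ) c₁) ^ 2 * s ^ 2 by ring, hs]
  have hys : (y : AlgebraicClosure ℚ) * s = algebraMap ℚ (AlgebraicClosure ℚ) (-(2 * c₁ * p)) := by
    rw [hyL, map_neg, map_mul, map_mul, map_natCast, map_ofNat]
    rw [show -(2 * algebraMap ℚ (AlgebraicClosure ℚ) c₁ * s) * s =
      -(2 * algebraMap ℚ (AlgebraicClosure ℚ) c₁ * s ^ 2) by ring, hs]
  obtain ⟨m, hm⟩ := exists_intCast_eq_of_isIntegral (q := 4 * c₁ ^ 2 * p)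
    (by rw [← hy2]; exact hyint.pow 2)
  obtain ⟨n, hn⟩ := exists_intCast_eq_of_isIntegral (q := -(2 * c₁ * p))
    (by rw [← hys]; exact hyint.mul hsint)
  -- `m p = n²` in `ℤ`, hence `p ∣ m`
  have hmn : m * p = n ^ 2 := by
    have h : ((m * p : ℤ) : ℚ) = ((n ^ 2 : ℤ) : ℚ) := by
      push_cast
      rw [hm, hn]
      ring
    exact_mod_cast h
  have hpi : Prime (p : ℤ) := Nat.prime_iff_prime_int.mp hp
  have hpn : (p : ℤ) ∣ n := hpi.dvd_of_dvd_pow (show (p : ℤ) ∣ n ^ 2 from ⟨m, by rw [← hmn, mul_comm]⟩)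
  obtain ⟨k, hk⟩ := hpn
  have hmk : m = p * k ^ 2 := by
    have hp0 : (p : ℤ) ≠ 0 := by exact_mod_cast hp.ne_zero
    apply mul_right_cancel₀ hp0
    rw [hmn, hk]
    ring
  -- `y² = p · k²` in `\bar ℤ`, so `y² ∈ 𝔓` and `y ∈ 𝔓`
  have hy2' : y ^ 2 = algebraMap (𝓞 ℚ) (absIntegers (𝓞 ℚ) ℚ) p *
      algebraMap (𝓞 ℚ) (absIntegers (𝓞 ℚ) ℚ) ((k : 𝓞 ℚ) ^ 2) := by
    apply Subtype.ext
    change (y : AlgebraicClosure ℚ) ^ 2 = algebraMap (𝓞 ℚ) (AlgebraicClosure ℚ) p *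
      algebraMap (𝓞 ℚ) (AlgebraicClosure ℚ) ((k : 𝓞 ℚ) ^ 2)
    rw [hy2, ← hm, hmk]
    simp only [map_intCast, map_natCast, map_pow, map_mul, Int.cast_mul, Int.cast_pow,
      Int.cast_natCast]
  have hmem2 : y ^ 2 ∈ 𝔓 := by
    rw [hy2']
    exact 𝔓.mul_mem_right _ hp𝔓
  exact Ideal.IsPrime.mem_of_pow_mem ‹𝔓.IsPrime› 2 hmem2

/-- **Inertia at `p` moves `√p`.**  For a prime `p`, a finite place `v ∋ p` of `𝓞 ℚ`, a prime
`𝔓` of `\bar ℤ` above `v` and `s ∈ ℚ̄` with `s² = p`, some `σ ∈ I_𝔓 ≤ Gal(ℚ̄/ℚ)` has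
`σ s = -s`: the conjugation of `ℚ(√p)` is an inertia element at `𝔓 ∩ ℚ(√p)`
(`mem_inertia_comap_of_apply_gen_eq_neg`, ramification of `p` in `ℚ(√p)`), and inertia surjects
onto inertia along `ℚ̄ ⊇ ℚ(√p) ⊇ ℚ` (`exists_mem_inertia_absRestrictNormalHom_eq`, Serre,
*Local Fields*, Ch. I §7, Prop. 22 (b)).  Neukirch, *ANT*, Ch. I §9, (9.4)–(9.6).
[cite: NeukirchANT1999, Ch. I §9 (9.4)–(9.6) with §8] [cite: SerreLocalFields1979, Ch. I §7 Prop. 22(b)] -/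
theorem exists_mem_inertia_smul_eq_neg_of_sq_eq_prime {v : HeightOneSpectrum (𝓞 ℚ)}
    (hv : (p : 𝓞 ℚ) ∈ v.asIdeal) {𝔓 : Ideal (absIntegers (𝓞 ℚ) ℚ)} (h𝔓 : 𝔓 ∈ v.primesAbove) :
    ∃ σ ∈ 𝔓.inertia (absoluteGaloisGroup ℚ), σ • s = -s := by
  haveI : 𝔓.IsPrime := h𝔓.1
  haveI := isQuadraticExtension_adjoin_of_sq_eq_prime hp hs
  haveI : FiniteDimensional ℚ ℚ⟮s⟯ :=
    IntermediateField.adjoin.finiteDimensional (isIntegral_of_sq_eq_prime hs)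
  have hp𝔓 : algebraMap (𝓞 ℚ) (absIntegers (𝓞 ℚ) ℚ) p ∈ 𝔓 := by
    rw [← Ideal.mem_comap, ← Ideal.under_def, ← h𝔓.2.over]
    exact hv
  obtain ⟨g, hg⟩ := exists_algEquiv_apply_gen_eq_neg hp hs
  have hfd : FiniteDimensional ℚ ℚ⟮s⟯ := inferInstance
  have hno : Normal ℚ ℚ⟮s⟯ := Algebra.IsQuadraticExtension.normal ℚ ℚ⟮s⟯
  obtain ⟨σ, hσ, hσg⟩ := @exists_mem_inertia_absRestrictNormalHom_eq ℚ _ (𝓞 ℚ) _ _ 𝔓 _ ℚ⟮s⟯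
    hfd hno g (mem_inertia_comap_of_apply_gen_eq_neg hp hs hp𝔓 g hg)
  refine ⟨σ, hσ, ?_⟩
  -- evaluate `σ|_E = g` at the generator `√p` (the `ℚ`-algebra structure on `ℚ⟮s⟯` seen by
  -- instance search is `DivisionRing.toRatAlgebra`, so the `Normal` instance is passed explicitly)
  have h2 := congrArg (fun τ ↦ ((τ (IntermediateField.AdjoinSimple.gen ℚ s) : ℚ⟮s⟯) :
    AlgebraicClosure ℚ)) hσg
  have h3 := h2.trans hg
  rw [← h3]
  exact (@AlgEquiv.restrictNormalHom_apply ℚ _ (AlgebraicClosure ℚ) _ _ ℚ⟮s⟯ hno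
    (absoluteGaloisGroup.toAlgEquiv ℚ σ) (IntermediateField.AdjoinSimple.gen ℚ s)).symm

end SqrtPrime

end Literature.NumberTheory.GaloisRepresentations

end
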